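import Summits.ValiantsHypothesis.ValiantsHypothesis.Theorems.MonotoneRestorationOrbitRestorationQPBlockProducts
import HarnessLib

/-!
# Equivariant SYSTEMS of block products restore: many-term depth-three representations whose terms are
# permuted as VALUES while their factor multisets are sign-twisted (ORBIT currency)

Route MonotoneRestoration, crux `OrbitRestorationQP` (stmt-ValiantsHypothesis-18293), line `depth-three-rung`, rung
`A_∞ = stub_sigmaPiSigmaValue`; namespace `Summit.ValiantsHypothesis.ValiantsHypothesis.Theorems.TermBlocks`.

The block criterion `BlockProducts.qpOrbitRestorable_of_blocks` restores ONE diagonally invariant affine product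
`a · Π_b Π M_b` whose factors are grouped into equivariant blocks.  The open residue of the rung, however, lives in
MANY-TERM representations `p = Σ_t a_t · F_t`: the landed kinds of `GroupableUpTo` ask either that every term be
matrix-symmetric (kind (S), i.e. the one-term criterion term by term) or that the factor MULTISETS be tame (kind (T):
quasi-polynomially many diagonal translates).  Neither covers a system of terms that are permuted EXACTLY AS VALUES,
`σ · F_t = F_{σ • t}`, while the factor multiset of each term is only permuted up to units by the stabiliser of the
term — e.g. `e₂(D_1, …, D_n) = Σ_{j<j'} D_j D_{j'}` with `D_j = Π_{i<i'} (x_{ij} − x_{i'j})` the column Vandermondes: the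
row transpositions fix the term index `{j, j'}` and act on its `n(n−1)` factor lines by the sign character, so the
factor multiset of `D_j D_{j'}` has `≥ n!/2` diagonal translates in EVERY affine factorisation, and no term is
matrix-symmetric; yet pairing the factor `(x_{ij} − x_{i'j})` with `(x_{ij'} − x_{i'j'})` gives blocks
`w_{{i,i'},{j,j'}}` whose PRODUCTS are honestly permuted (companion file `…TermBlocksPairedVandermondes.lean`).

* `qpOrbitRestorable_of_termBlocks` — **THE TERM-BLOCK CRITERION.**  Let `B` (blocks) and `T` (terms) be finite
  `Sym(Fin n)`-sets with an equivariant key `key : B → T`, `M_b` multisets of affine forms and `a : T → ℂ` an invariant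
  coefficient.  Suppose (i) every form is fixed by the pointwise stabiliser of `≤ k` indices, (ii) every `M_b` is
  mapped to itself by the pointwise stabiliser of `≤ k` indices, (iii) `σ · Π M_b = Π M_{σ • b}`, (iv) every term
  carrying a non-empty block is fixed by the pointwise stabiliser of `≤ k` indices.  Then
  `Σ_t C(a t) · Π_{key b = t} Π M_b` is `QPOrbitRestorable (k + 5)` at level `n`: the wide derivation
  variables/`1` → forms (free sums) → block products (operand multisets of orbit `≤ (n+1)^k`) → term products (operand
  multiset `{Π M_b : key b = t}` moves like `t`, orbit `≤ (n+1)^k`) → the output sum (free), and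
  `ValueOrbit.qpOrbit_of_wide`.  With `T` a point this is the block criterion; with all blocks singletons of
  untwisted forms it is kind (T) of the residue.
* `ncard_range_le_of_stab` — an equivariant function of a term with a `k`-point pointwise stabiliser takes
  `≤ (n+1)^k` values along `Sym(Fin n)`.

Honest label: a positive-lane criterion (new groupable KIND for the residue bookkeeping of `A_∞`: "tame after an
equivariant blocking of the factors"); the stub, the crux and VP ≠ VNP are not moved.  Everything is proved. [folklore]

## References
* A. Dawar, G. Wilsenach, *Symmetric arithmetic circuits*, ToC 21 (2025), §3.3, Def. 6.1. [DawarWilsenach2025]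
-/

noncomputable section

open scoped Classical Pointwise

-- `Summit.ValiantsHypothesis.ValiantsHypothesis.…` is the tree's single-conjunct layout (Sub = Summit).
set_option linter.dupNamespace false

namespace Summit.ValiantsHypothesis.ValiantsHypothesis.Theorems

namespace TermBlocks

open Equiv Finset Literature.Computability.AlgebraicComplexity OrbitRestorationQPDepthThreeRung BlockProducts

variable {n : ℕ}

/-- **An equivariant function of a term fixed by the pointwise stabiliser of `K` takes at most `(n+1)^|K|` values
along `Sym(Fin n)`.** [folklore; cite: DawarWilsenach2025, Def. 6.1] -/
theorem ncard_range_le_of_stab {T β : Type*} [MulAction (Perm (Fin n)) T] {K : Finset (Fin n)} {t : T}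
    (hK : ∀ σ : Perm (Fin n), (∀ x ∈ K, σ x = x) → σ • t = t) (G : T → β) :
    (Set.range fun σ : Perm (Fin n) => G (σ • t)).ncard ≤ (n + 1) ^ K.card := by
  have hagree : ∀ σ τ : Perm (Fin n), (∀ i ∈ K, σ i = τ i) → G (σ • t) = G (τ • t) := by
    intro σ τ hστ
    have hfix : (τ⁻¹ * σ) • t = t := hK (τ⁻¹ * σ) fun i hi => by
      rw [Perm.mul_apply, hστ i hi]; exact τ.symm_apply_apply i
    have h := congrArg (fun s => τ • s) hfix
    simp only [smul_smul, mul_inv_cancel_left] at h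
    rw [h]
  refine (ncard_range_le_pow_of_agree K _ hagree).trans ?_
  rw [Fintype.card_fin]; exact Nat.pow_le_pow_left (Nat.le_succ n) _

/-- **THE TERM-BLOCK CRITERION: an equivariant system of block products of supported affine forms, summed with an
invariant coefficient over a finite `Sym(Fin n)`-set of terms, is orbit-restorable.**  Blocks `b : B` carry multisets
`M b` of affine forms and an equivariant key `key b : T`; (i) every form is fixed by the pointwise stabiliser of `≤ k`
indices, (ii) every `M b` is mapped to itself by the pointwise stabiliser of `≤ k` indices, (iii)
`σ · Π M_b = Π M_{σ • b}`, (iv) every term carrying a non-empty block is fixed by the pointwise stabiliser of `≤ k`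
indices, and `a (σ • t) = a t`.  Then `Σ_t C(a t) · Π_{key b = t} Π M_b` is `QPOrbitRestorable (k + 5)` at level `n`.
[folklore; cite: DawarWilsenach2025, §3.3 and Def. 6.1] -/
theorem qpOrbitRestorable_of_termBlocks {k : ℕ} {B T : Type} [Fintype B] [Fintype T]
    [MulAction (Perm (Fin n)) B] [MulAction (Perm (Fin n)) T]
    (key : B → T) (hkey : ∀ (σ : Perm (Fin n)) (b : B), key (σ • b) = σ • key b)
    (M : B → Multiset (MvPolynomial (Fin n × Fin n) ℂ)) (a : T → ℂ)
    (ha : ∀ (σ : Perm (Fin n)) (t : T), a (σ • t) = a t)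
    (hAff : ∀ b, ∀ q ∈ M b, q.totalDegree ≤ 1)
    (hSupp : ∀ b, ∀ q ∈ M b, ∃ X : Finset (Fin n), X.card ≤ k ∧
      ∀ σ : Perm (Fin n), (∀ x ∈ X, σ x = x) → ren σ q = q)
    (hPerm : ∀ b, ∃ K : Finset (Fin n), K.card ≤ k ∧
      ∀ σ : Perm (Fin n), (∀ x ∈ K, σ x = x) → (M b).map (ren σ) = M b)
    (hEqv : ∀ (σ : Perm (Fin n)) (b : B), ren σ (M b).prod = (M (σ • b)).prod)
    (hT : ∀ t : T, (∃ b, key b = t ∧ M b ≠ 0) → ∃ K : Finset (Fin n), K.card ≤ k ∧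
      ∀ σ : Perm (Fin n), (∀ x ∈ K, σ x = x) → σ • t = t) :
    QPOrbitRestorable (k + 5) n
      (∑ t, MvPolynomial.C (a t) * ∏ b ∈ univ.filter (fun b => key b = t), (M b).prod) := by
  set L := Nat.log 2 n with hL
  set Bw := 2 ^ ((L + (k + 2)) ^ (k + 2)) with hBw
  have hBw1 : 1 ≤ Bw := Nat.one_le_two_pow
  have hpow : ∀ {j : ℕ}, j ≤ k → (n + 1) ^ j ≤ Bw := fun hj =>
    (Nat.pow_le_pow_right (Nat.succ_pos n) hj).trans (pow_succ_le_qp n k)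
  -- the term products, with indicator factors `1` for the blocks of other terms
  set F : T → MvPolynomial (Fin n × Fin n) ℂ := fun t => ∏ b, if key b = t then (M b).prod else 1 with hF
  have hFt : ∀ t, ∏ b ∈ univ.filter (fun b => key b = t), (M b).prod = F t := fun t => by
    rw [hF, Finset.prod_filter]
  simp only [hFt]
  set f : MvPolynomial (Fin n × Fin n) ℂ := ∑ t, MvPolynomial.C (a t) * F t with hf
  -- the operand multisets of the term products
  set N : T → Multiset (MvPolynomial (Fin n × Fin n) ℂ) :=
    fun t => (univ : Finset B).val.map fun b => if key b = t then (M b).prod else 1 with hN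
  have hNprod : ∀ t, (N t).prod = F t := fun t => by
    rw [hN, hF]; exact (Finset.prod_eq_multiset_prod _ _).symm
  -- key bookkeeping
  have hkey_iff : ∀ (σ : Perm (Fin n)) (b : B) (t : T), key (σ • b) = σ • t ↔ key b = t := fun σ b t => by
    rw [hkey]; exact (MulAction.injective σ).eq_iff
  -- equivariance of the term products and of their operand multisets
  have hFren : ∀ (σ : Perm (Fin n)) (t : T), ren σ (F t) = F (σ • t) := by
    intro σ t
    rw [hF]
    simp only [map_prod]
    refine Fintype.prod_equiv (MulAction.toPerm σ) _ _ fun b => ?_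
    simp only [MulAction.toPerm_apply]
    by_cases hb : key b = t
    · rw [if_pos hb, if_pos ((hkey_iff σ b t).2 hb), hEqv]
    · rw [if_neg hb, if_neg (mt (hkey_iff σ b t).1 hb), map_one]
  have hNren : ∀ (σ : Perm (Fin n)) (t : T), (N t).map (ren σ) = N (σ • t) := by
    intro σ t
    rw [hN, Multiset.map_map]
    have hc : (ren σ) ∘ (fun b => if key b = t then (M b).prod else 1) =
        (fun b => if key b = σ • t then (M b).prod else 1) ∘ (MulAction.toPerm σ) := by
      funext b
      simp only [Function.comp_apply, MulAction.toPerm_apply]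
      by_cases hb : key b = t
      · rw [if_pos hb, if_pos ((hkey_iff σ b t).2 hb), hEqv]
      · rw [if_neg hb, if_neg (mt (hkey_iff σ b t).1 hb), map_one]
    rw [hc, ← Multiset.map_map, Multiset.map_univ_val_equiv]
  -- invariance of the output
  have hffix : ∀ σ : Perm (Fin n), ren σ f = f := by
    intro σ
    rw [hf, map_sum]
    simp only [map_mul, ren_C, hFren]
    exact Fintype.sum_equiv (MulAction.toPerm σ) _ _ fun t => by
      simp only [MulAction.toPerm_apply, ha]
  -- the values
  set S0 : Finset (MvPolynomial (Fin n × Fin n) ℂ) :=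
    insert (MvPolynomial.C 1) ((univ : Finset (Fin n × Fin n)).image MvPolynomial.X) with hS0
  set S1 : Finset (MvPolynomial (Fin n × Fin n) ℂ) := (univ : Finset B).biUnion fun b => (M b).toFinset
    with hS1
  set S2 : Finset (MvPolynomial (Fin n × Fin n) ℂ) := (univ : Finset B).image fun b => (M b).prod with hS2
  set S3 : Finset (MvPolynomial (Fin n × Fin n) ℂ) := (univ : Finset T).image F with hS3
  set S : Finset (MvPolynomial (Fin n × Fin n) ℂ) := S0 ∪ S1 ∪ S2 ∪ S3 ∪ {f} with hS
  set rank : MvPolynomial (Fin n × Fin n) ℂ → ℕ := fun q =>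
    if q ∈ S0 then 0 else if q ∈ S1 then 1 else if q ∈ S2 then 2 else if q ∈ S3 then 3 else 4 with hrank
  -- membership facts
  have hC1 : MvPolynomial.C 1 ∈ S0 := Finset.mem_insert_self _ _
  have hXm : ∀ p, MvPolynomial.X p ∈ S0 := fun p =>
    Finset.mem_insert_of_mem (Finset.mem_image.2 ⟨p, Finset.mem_univ p, rfl⟩)
  have hS0S : S0 ⊆ S := by
    intro q hq; simp only [hS, Finset.mem_union]; exact Or.inl (Or.inl (Or.inl (Or.inl hq)))
  have hS1S : S1 ⊆ S := by
    intro q hq; simp only [hS, Finset.mem_union]; exact Or.inl (Or.inl (Or.inl (Or.inr hq)))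
  have hS2S : S2 ⊆ S := by
    intro q hq; simp only [hS, Finset.mem_union]; exact Or.inl (Or.inl (Or.inr hq))
  have hS3S : S3 ⊆ S := by
    intro q hq; simp only [hS, Finset.mem_union]; exact Or.inl (Or.inr hq)
  have hfS : f ∈ S := by simp [hS]
  have hmemS1 : ∀ b, ∀ q ∈ M b, q ∈ S1 := fun b q hq =>
    Finset.mem_biUnion.2 ⟨b, Finset.mem_univ b, Multiset.mem_toFinset.2 hq⟩
  have hmemS2 : ∀ b, (M b).prod ∈ S2 := fun b => Finset.mem_image.2 ⟨b, Finset.mem_univ b, rfl⟩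
  have hmemS3 : ∀ t, F t ∈ S3 := fun t => Finset.mem_image.2 ⟨t, Finset.mem_univ t, rfl⟩
  have hrank0 : ∀ q ∈ S0, rank q = 0 := fun q hq => by simp only [hrank, if_pos hq]
  have hrank1 : ∀ q ∈ S1, rank q ≤ 1 := fun q hq => by
    simp only [hrank]; split_ifs <;> omega
  have hrank2 : ∀ q ∈ S2, rank q ≤ 2 := fun q hq => by
    simp only [hrank]; split_ifs <;> omega
  have hrank3 : ∀ q ∈ S3, rank q ≤ 3 := fun q hq => by
    simp only [hrank]; split_ifs <;> omega
  -- orbit of an invariant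
  have horb_inv : ∀ {q : MvPolynomial (Fin n × Fin n) ℂ}, (∀ σ : Perm (Fin n), ren σ q = q) →
      (Set.range fun σ : Perm (Fin n) => ren σ q).ncard ≤ Bw := fun hq =>
    (ValueOrbit.ncard_orbit_of_invariant hq).trans hBw1
  -- a term product outside `S0` carries a non-empty block
  have hne : ∀ t, F t ∉ S0 → ∃ b, key b = t ∧ M b ≠ 0 := by
    intro t ht
    by_contra hcon
    push Not at hcon
    apply ht
    have h1 : F t = MvPolynomial.C 1 := by
      rw [hF, map_one]
      refine Finset.prod_eq_one fun b _ => ?_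
      by_cases hb : key b = t
      · rw [if_pos hb, hcon b hb, Multiset.prod_zero]
      · rw [if_neg hb]
    rw [h1]; exact hC1
  -- THE WIDTH STATEMENT
  have W : ∀ q ∈ S, (Set.range fun σ : Perm (Fin n) => ren σ q).ncard ≤ Bw ∧
      ∃ d : WStep ℂ (Fin n × Fin n), d.Valid S rank q ∧
        ∀ N', d = WStep.prod N' → (Set.range fun σ : Perm (Fin n) => N'.map (ren σ)).ncard ≤ Bw := by
    intro q hq
    by_cases h0 : q ∈ S0
    · -- variables and the constant `1`
      rcases Finset.mem_insert.1 h0 with rfl | hx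
      · refine ⟨horb_inv fun σ => ren_C σ 1, WStep.const 1, ⟨rfl, fun u hu => by simp [WStep.args] at hu⟩,
          fun N' h => by cases h⟩
      · obtain ⟨p, -, rfl⟩ := Finset.mem_image.1 hx
        refine ⟨?_, WStep.var p, ⟨rfl, fun u hu => by simp [WStep.args] at hu⟩, fun N' h => by cases h⟩
        refine le_trans ?_ ((ValueOrbit.ncard_orbit_var_le n p).trans (sq_le_qp n k))
        exact TermCircuit.ncard_range_le_of_factor _ (fun σ : Perm (Fin n) => σ • p) MvPolynomial.X
          fun σ => ren_X σ p
    by_cases h1 : q ∈ S1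
    · -- an affine form: one (free) sum step from the variables and `1`
      obtain ⟨b, -, hqb⟩ := Finset.mem_biUnion.1 h1
      have hqM : q ∈ M b := Multiset.mem_toFinset.1 hqb
      have hrq : rank q = 1 := by simp only [hrank, if_neg h0, if_pos h1]
      refine ⟨?_, WStep.sum ((MvPolynomial.coeff 0 q, MvPolynomial.C 1) ::ₘ
        ((univ : Finset (Fin n × Fin n)).val.map fun p => (MvPolynomial.coeff (Finsupp.single p 1) q,
          MvPolynomial.X p))), ⟨?_, fun u hu => ?_⟩, fun N' h => by cases h⟩
      · obtain ⟨X, hXk, hX⟩ := hSupp b q hqM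
        exact (ValueOrbit.orbit_bounded_of_supported hX).trans (hpow hXk)
      · rw [WStep.value, Multiset.map_cons, Multiset.sum_cons, Multiset.map_map, map_one, mul_one]
        conv_rhs => rw [eqvTerms_affine_eq q (hAff b q hqM), Finset.sum_eq_multiset_sum]
        rfl
      · simp only [WStep.args, Multiset.map_cons, Multiset.map_map, Function.comp_def, Multiset.mem_cons,
          Multiset.mem_map, Finset.mem_val, Finset.mem_univ, true_and] at hu
        have hu0 : u ∈ S0 := by
          rcases hu with rfl | ⟨p, rfl⟩
          · exact hC1
          · exact hXm p
        exact ⟨hS0S hu0, by rw [hrank0 u hu0, hrq]; exact Nat.zero_lt_one⟩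
    by_cases h2 : q ∈ S2
    · -- a block product: operand multiset exactly permuted by a small pointwise stabiliser
      obtain ⟨b, -, rfl⟩ := Finset.mem_image.1 h2
      obtain ⟨K, hKk, hK⟩ := hPerm b
      have hrq : rank (M b).prod = 2 := by simp only [hrank, if_neg h0, if_neg h1, if_pos h2]
      refine ⟨(ValueOrbit.orbit_bounded_of_supported (ren_prod_eq_of_perm hK)).trans (hpow hKk),
        WStep.prod (M b), ⟨rfl, fun u hu => ?_⟩, fun N' h => ?_⟩
      · have hu1 : u ∈ S1 := hmemS1 b u hu
        exact ⟨hS1S hu1, by rw [hrq]; exact Nat.lt_of_le_of_lt (hrank1 u hu1) (by norm_num)⟩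
      · cases h
        exact (ncard_range_map_le_of_perm hK).trans (hpow hKk)
    by_cases h3 : q ∈ S3
    · -- a term product: operand multiset `{Π M_b : key b = t}` (padded with `1`s) moves like `t`
      obtain ⟨t, -, rfl⟩ := Finset.mem_image.1 h3
      obtain ⟨K, hKk, hK⟩ := hT t (hne t h0)
      have hrq : rank (F t) = 3 := by simp only [hrank, if_neg h0, if_neg h1, if_neg h2, if_pos h3]
      refine ⟨?_, WStep.prod (N t), ⟨hNprod t, fun u hu => ?_⟩, fun N' h => ?_⟩
      · have hrange : (Set.range fun σ : Perm (Fin n) => ren σ (F t)) =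
            Set.range fun σ : Perm (Fin n) => F (σ • t) := by
          simp only [hFren]
        rw [hrange]
        exact (ncard_range_le_of_stab hK F).trans (hpow hKk)
      · simp only [WStep.args, hN, Multiset.mem_map, Finset.mem_val, Finset.mem_univ, true_and] at hu
        obtain ⟨b, rfl⟩ := hu
        by_cases hb : key b = t
        · rw [if_pos hb]
          exact ⟨hS2S (hmemS2 b), by rw [hrq]; exact Nat.lt_of_le_of_lt (hrank2 _ (hmemS2 b)) (by norm_num)⟩
        · rw [if_neg hb, ← MvPolynomial.C_1]
          exact ⟨hS0S hC1, by rw [hrq, hrank0 _ hC1]; norm_num⟩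
      · cases h
        have hrange : (Set.range fun σ : Perm (Fin n) => (N t).map (ren σ)) =
            Set.range fun σ : Perm (Fin n) => N (σ • t) := by
          simp only [hNren]
        rw [hrange]
        exact (ncard_range_le_of_stab hK N).trans (hpow hKk)
    · -- the output `f = Σ_t a_t · F_t`: a (free) sum step
      have hqf : q = f := by
        simp only [hS, Finset.mem_union, Finset.mem_singleton] at hq
        rcases hq with (((hq | hq) | hq) | hq) | hq
        · exact absurd hq h0
        · exact absurd hq h1
        · exact absurd hq h2
        · exact absurd hq h3
        · exact hq
      subst hqf
      have hrq : rank f = 4 := by simp only [hrank, if_neg h0, if_neg h1, if_neg h2, if_neg h3]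
      refine ⟨horb_inv hffix, WStep.sum ((univ : Finset T).val.map fun t => (a t, F t)), ⟨?_, fun u hu => ?_⟩,
        fun N' h => by cases h⟩
      · rw [WStep.value, Multiset.map_map, hf, Finset.sum_eq_multiset_sum]
        rfl
      · simp only [WStep.args, Multiset.map_map, Function.comp_def, Multiset.mem_map, Finset.mem_val,
          Finset.mem_univ, true_and] at hu
        obtain ⟨t, rfl⟩ := hu
        exact ⟨hS3S (hmemS3 t), by rw [hrq]; exact Nat.lt_of_le_of_lt (hrank3 _ (hmemS3 t)) (by norm_num)⟩
  -- the wide derivation and its width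
  let 𝒲 : WideDerivation ℂ (Fin n × Fin n) :=
    { S := S, rank := rank, step := fun q hq => by
        obtain ⟨-, d, hd, -⟩ := W q hq
        exact ⟨d, hd⟩ }
  have hW : 𝒲.OrbitWidthLE (Perm (Fin n)) Bw := fun q hq => W q hq
  obtain ⟨G, inst, C, hC, hev, horb⟩ := ValueOrbit.qpOrbit_of_wide (c := k + 2) 𝒲 hfS hffix hW
  exact ⟨G, inst, C, hC, hev, horb⟩

end TermBlocks

end Summit.ValiantsHypothesis.ValiantsHypothesis.Theorems

end
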